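import Literature.AlgebraicGeometry.HodgeTheory.GysinBaseChangeOfKunneth
import Literature.AlgebraicGeometry.HodgeTheory.ComplexGysinHodgeType
import Literature.AlgebraicTopology.SingularHomology.GysinTransposition

/-!
# Route NikulinTwinTransport · `SquareGlue` (stmt-HodgeConjecture-13682) — Künneth bookkeeping I:
# what the spanning half of the Künneth formula gives on a product of two smooth projective varieties

Helper file for the glue item `SquareGlue` (`RealMultiplicationSqrtTwoAlgebraic → LefschetzOneOneK3 →
SquareHodgeOfSqrtTwo`: the Künneth bookkeeping turning "real multiplication by `√2` is algebraic"
into `HodgeConjectureFor 4 (S ⊗ S)`). The tree has no Künneth theorem for the complex points of a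
product `(Y ⊗ Z)(ℂ) = Y(ℂ) × Z(ℂ)`; as in the sibling files of this route
(`NikulinTwinTransportHodgeIsometryAlgebraicGysinBaseChange`, `…HodgeSimilitudeAlgebraicFrontier`)
the SPANNING half — every class on `(Y ⊗ Z)(ℂ)` is a `ℂ`-combination of cross products
`fst^* b ∪ snd^* w` (Hatcher, *Algebraic Topology*, Thm. 3.15 with Cor. A.12) — is taken as a
hypothesis, here only in the single degree each statement needs (`hKl`, `hKtop`). PROVED from it
and from the tree's Poincaré duality formalism (`eq_zero_of_forall_cupPairing_eq_zero`: the cup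
product pairing of `X(ℂ)` is perfect; `cupPairing_gysinMap`: `f_*` is the transpose of `f^*`):

* `eq_zero_of_forall_cupPairing_cross_eq_zero` — a class on `(Y ⊗ Z)(ℂ)` pairing to zero with every
  cross product of complementary degree is zero (the "uniqueness half" of Künneth that the
  bookkeeping needs: a class is determined by its Künneth pairings);
* `cupPairing_corrFst_eq`, `cupPairing_corrSnd_eq` — the pairing of `c` with `fst^* b ∪ snd^* w` is,
  up to the Koszul sign, the pairing on `Y(ℂ)` of the correspondence-type class
  `fst_*(snd^* w ∪ c)` with `b` (resp. on `Z(ℂ)` of `snd_*(fst^* b ∪ c)` with `w`);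
* `exists_eq_smul_cross_of_top` — the top cohomology of `(Y ⊗ Z)(ℂ)` is the line spanned by
  `fst^* ω₀ ∪ snd^* w₀` for any non-zero top classes `ω₀`, `w₀`;
* `exists_fibreIntegral_fst`, `exists_fibreIntegral_snd` — FIBRE INTEGRATION: `fst_*(snd^* w₀) = κ • 1`
  with `κ ≠ 0` (and symmetrically), the hypothesis (FI) of
  `NikulinTwinTransportRealMultiplicationDivisorCorrespondences`.

No new definitions, no named facts. Prover seat prover-pitem-stmt-HodgeConjecture-13682-0.
-/

noncomputable section

namespace Summit.HodgeConjecture.HodgeConjecture.Theorems.NikulinTwinTransport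

open CategoryTheory MonoidalCategory CartesianMonoidalCategory
open Literature.AlgebraicGeometry.Motives Literature.AlgebraicGeometry.HodgeTheory
open Literature.AlgebraicTopology.SingularHomology

variable {m n : ℕ} {Y Z : SchemeOver ℂ}

/-! ### A class is determined by its pairings with cross products -/

/-- **Uniqueness from the Künneth spanning property.** If every class of degree `l` on
`(Y ⊗ Z)(ℂ)` is a combination of cross products `fst^* b ∪ snd^* w` (`hKl`), then a class `c` of
the complementary degree `k` (`k + l = 2 (dim Y + dim Z)`) which pairs to zero with every cross
product is zero: the functional `⟨c ∪ –, [(Y ⊗ Z)(ℂ)]⟩` vanishes on a spanning set, and the cup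
product pairing of the closed oriented manifold `(Y ⊗ Z)(ℂ)` is perfect
(`eq_zero_of_forall_cupPairing_eq_zero`). [cite: HatcherAT2002, §3.2 Thm. 3.15 and §3.3 Prop. 3.38] -/
theorem eq_zero_of_forall_cupPairing_cross_eq_zero (μ : OrientationFamily)
    (hY : IsSmoothProjective m Y) (hZ : IsSmoothProjective n Z) {k l : ℕ} (hkl : k + l = 2 * (m + n))
    (hKl : ∀ z : complexBetti (Y ⊗ Z) l, z ∈ Submodule.span ℂ
      {v | ∃ (i j : ℕ) (h : i + j = l) (b : complexBetti Y i) (w : complexBetti Z j),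
        v = cupProduct h (complexBetti.map (fst Y Z) i b) (complexBetti.map (snd Y Z) j w)})
    {c : complexBetti (Y ⊗ Z) k}
    (h : ∀ (i j : ℕ) (hij : i + j = l) (b : complexBetti Y i) (w : complexBetti Z j),
      cupPairing (μ (IsSmoothProjective.tensor_holds hY hZ)) hkl c
        (cupProduct hij (complexBetti.map (fst Y Z) i b) (complexBetti.map (snd Y Z) j w)) = 0) :
    c = 0 := by
  refine eq_zero_of_forall_cupPairing_eq_zero μ (IsSmoothProjective.tensor_holds hY hZ) hkl fun z ↦ ?_
  refine Submodule.span_induction (p := fun z _ ↦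
      cupPairing (μ (IsSmoothProjective.tensor_holds hY hZ)) hkl c z = 0) ?_ ?_ ?_ ?_ (hKl z)
  · rintro _ ⟨i, j, hij, b, w, rfl⟩
    exact h i j hij b w
  · exact map_zero _
  · intro x y _ _ hx hy
    rw [map_add, hx, hy, add_zero]
  · intro t x _ hx
    rw [map_smul, hx, smul_zero]

/-! ### Pairings with cross products are pairings of correspondence-type classes on a factor -/

/-- **`⟨fst_*(snd^* w ∪ c) ∪ b, [Y]⟩ = ± ⟨c ∪ (fst^* b ∪ snd^* w), [Y ⊗ Z]⟩`.** For
`c ∈ Hᵏ((Y ⊗ Z)(ℂ))`, `b ∈ Hⁱ(Y(ℂ))`, `w ∈ Hʲ(Z(ℂ))` with `i + j = l`, `k + l = 2(dim Y + dim Z)` and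
`fst_* : H^{j+k}((Y ⊗ Z)(ℂ)) → H^{i'}(Y(ℂ))` (`i' + i = 2 dim Y`) the Gysin morphism of the orientation
family `μ`: `f_*` is the transpose of `f^*` for the cup product pairings (`cupPairing_gysinMap`), and
`(snd^* w ∪ c) ∪ fst^* b = (-1)^{jk + ji} c ∪ (fst^* b ∪ snd^* w)` (associativity and graded
commutativity of `∪`). [cite: HatcherAT2002, §3.2 Thm. 3.11 and §3.3 p. 249]
[cite: FultonYoungTableaux1997, Appendix B §B.1 (5)] -/
theorem cupPairing_corrFst_eq (μ : OrientationFamily)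
    (hY : IsSmoothProjective m Y) (hZ : IsSmoothProjective n Z) {k l i j a i' : ℕ}
    (hkl : k + l = 2 * (m + n)) (hij : i + j = l) (hja : j + k = a)
    (hab : a + 2 * m = i' + 2 * (m + n)) (hi : i' + i = 2 * m)
    (c : complexBetti (Y ⊗ Z) k) (b : complexBetti Y i) (w : complexBetti Z j) :
    cupPairing (μ hY) hi
        (complexGysin μ (IsSmoothProjective.tensor_holds hY hZ) hY (fst Y Z) hab
          (cupProduct hja (complexBetti.map (snd Y Z) j w) c)) b =
      (-1 : ℂ) ^ (j * k + j * i) *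
        cupPairing (μ (IsSmoothProjective.tensor_holds hY hZ)) hkl c
          (cupProduct hij (complexBetti.map (fst Y Z) i b) (complexBetti.map (snd Y Z) j w)) := by
  have ha : a + i = 2 * (m + n) := by omega
  rw [complexGysin_eq_gysinMap (IsSmoothProjective.tensor_holds hY hZ) hY (fst Y Z) hab ha hi,
    cupPairing_gysinMap (μ.hasPoincareDuality hY) _ ha hi, cupPairing_apply, cupPairing_apply]
  change kroneckerPairing ℂ ℂ _ _ (cupProduct ha (cupProduct hja (complexBetti.map (snd Y Z) j w) c)
      (complexBetti.map (fst Y Z) i b)) _ = _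
  have hkj : k + j = a := by omega
  have hji : j + i = l := by omega
  rw [cupProduct_gradedComm_holds ℂ _ hja hkj, LinearMap.map_smul₂,
    cupProduct_assoc hkj hji ha hkl, cupProduct_gradedComm_holds ℂ _ hji hij, map_smul, map_smul,
    map_smul, LinearMap.smul_apply, LinearMap.smul_apply, smul_eq_mul, smul_eq_mul, ← mul_assoc,
    ← pow_add]

/-- **`⟨snd_*(fst^* b ∪ c) ∪ w, [Z]⟩ = ± ⟨c ∪ (fst^* b ∪ snd^* w), [Y ⊗ Z]⟩`**, the symmetric
statement for the second projection (`snd_* : H^{i+k}((Y ⊗ Z)(ℂ)) → H^{j'}(Z(ℂ))`, `j' + j = 2 dim Z`;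
sign `(-1)^{ik}`). [cite: HatcherAT2002, §3.2 Thm. 3.11 and §3.3 p. 249]
[cite: FultonYoungTableaux1997, Appendix B §B.1 (5)] -/
theorem cupPairing_corrSnd_eq (μ : OrientationFamily)
    (hY : IsSmoothProjective m Y) (hZ : IsSmoothProjective n Z) {k l i j a j' : ℕ}
    (hkl : k + l = 2 * (m + n)) (hij : i + j = l) (hia : i + k = a)
    (hab : a + 2 * n = j' + 2 * (m + n)) (hj : j' + j = 2 * n)
    (c : complexBetti (Y ⊗ Z) k) (b : complexBetti Y i) (w : complexBetti Z j) :
    cupPairing (μ hZ) hj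
        (complexGysin μ (IsSmoothProjective.tensor_holds hY hZ) hZ (snd Y Z) hab
          (cupProduct hia (complexBetti.map (fst Y Z) i b) c)) w =
      (-1 : ℂ) ^ (i * k) *
        cupPairing (μ (IsSmoothProjective.tensor_holds hY hZ)) hkl c
          (cupProduct hij (complexBetti.map (fst Y Z) i b) (complexBetti.map (snd Y Z) j w)) := by
  have ha : a + j = 2 * (m + n) := by omega
  rw [complexGysin_eq_gysinMap (IsSmoothProjective.tensor_holds hY hZ) hZ (snd Y Z) hab ha hj,
    cupPairing_gysinMap (μ.hasPoincareDuality hZ) _ ha hj, cupPairing_apply, cupPairing_apply]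
  change kroneckerPairing ℂ ℂ _ _ (cupProduct ha (cupProduct hia (complexBetti.map (fst Y Z) i b) c)
      (complexBetti.map (snd Y Z) j w)) _ = _
  have hki : k + i = a := by omega
  rw [cupProduct_gradedComm_holds ℂ _ hia hki, LinearMap.map_smul₂, cupProduct_assoc hki hij ha hkl,
    map_smul, LinearMap.smul_apply, smul_eq_mul]

/-! ### The top cohomology of a product is the line of a cross product -/

/-- **`H^{2(dim Y + dim Z)}((Y ⊗ Z)(ℂ); ℂ) = ℂ · (fst^* ω₀ ∪ snd^* w₀)`** for non-zero top classes
`ω₀`, `w₀` of the factors, GRANTED the Künneth spanning property in the top degree: a cross product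
`fst^* b ∪ snd^* w` of total degree `2(dim Y + dim Z)` vanishes unless `deg b = 2 dim Y` and
`deg w = 2 dim Z` (cohomology above the real dimension vanishes, `subsingleton_complexBetti`), and
the top cohomology of each factor is a line (`exists_eq_smul_of_top`).
[cite: HatcherAT2002, §3.2 Thm. 3.15 and §3.3 Thm. 3.26] -/
theorem exists_eq_smul_cross_of_top (μ : OrientationFamily)
    (hY : IsSmoothProjective m Y) (hZ : IsSmoothProjective n Z)
    (hKtop : ∀ z : complexBetti (Y ⊗ Z) (2 * (m + n)), z ∈ Submodule.span ℂ
      {v | ∃ (i j : ℕ) (h : i + j = 2 * (m + n)) (b : complexBetti Y i) (w : complexBetti Z j),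
        v = cupProduct h (complexBetti.map (fst Y Z) i b) (complexBetti.map (snd Y Z) j w)})
    {ω₀ : complexBetti Y (2 * m)} (hω₀ : ω₀ ≠ 0) {w₀ : complexBetti Z (2 * n)} (hw₀ : w₀ ≠ 0)
    (h2 : 2 * m + 2 * n = 2 * (m + n)) (z : complexBetti (Y ⊗ Z) (2 * (m + n))) :
    ∃ t : ℂ, z = t • cupProduct h2 (complexBetti.map (fst Y Z) (2 * m) ω₀)
      (complexBetti.map (snd Y Z) (2 * n) w₀) := by
  refine Submodule.span_induction (p := fun z _ ↦ ∃ t : ℂ, z = t • cupProduct h2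
      (complexBetti.map (fst Y Z) (2 * m) ω₀) (complexBetti.map (snd Y Z) (2 * n) w₀)) ?_ ?_ ?_ ?_ (hKtop z)
  · rintro _ ⟨i, j, hij, b, w, rfl⟩
    rcases lt_or_ge (2 * m) i with hi | hi
    · haveI := subsingleton_complexBetti hY hi
      exact ⟨0, by rw [Subsingleton.elim b 0, map_zero, map_zero, LinearMap.zero_apply, zero_smul]⟩
    rcases lt_or_ge (2 * n) j with hj' | hj'
    · haveI := subsingleton_complexBetti hZ hj'
      exact ⟨0, by rw [Subsingleton.elim w 0, map_zero, map_zero, zero_smul]⟩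
    obtain rfl : i = 2 * m := by omega
    obtain rfl : j = 2 * n := by omega
    obtain ⟨s, rfl⟩ := exists_eq_smul_of_top μ hY hω₀ b
    obtain ⟨t, rfl⟩ := exists_eq_smul_of_top μ hZ hw₀ w
    refine ⟨t * s, ?_⟩
    simp only [map_smul, LinearMap.smul_apply, smul_smul]
  · exact ⟨0, by rw [zero_smul]⟩
  · rintro x y - - ⟨s, rfl⟩ ⟨t, rfl⟩
    exact ⟨s + t, by rw [add_smul]⟩
  · rintro r x - ⟨t, rfl⟩
    exact ⟨r * t, by rw [smul_smul]⟩

/-- **Some top class of `X(ℂ)` pairs non-trivially with the fundamental class** (`X` smooth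
projective of dimension `d`): `[X(ℂ)]_μ ≠ 0` and the Kronecker pairing maps `H^{2d}(X(ℂ); ℂ)` onto
the dual of `H_{2d}(X(ℂ); ℂ)` (universal coefficients over a field).
[cite: HatcherAT2002, §3.1 Thm. 3.2 and §3.3 Thm. 3.26] -/
theorem exists_kroneckerPairing_fundamentalClass_ne_zero (μ : OrientationFamily) {d : ℕ}
    {X : SchemeOver ℂ} (hX : IsSmoothProjective d X) :
    ∃ G : complexBetti X (2 * d), kroneckerPairing ℂ ℂ (ComplexPoints X) (2 * d) G (μ hX).fundamentalClass ≠ 0 := by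
  letI := hX.chartedSpace
  haveI := ComplexPoints.compactSpace_of_isSmoothProjective hX
  haveI := ComplexPoints.t2Space_of_isSmoothProjective hX
  haveI := connectedSpace_complexPoints hX
  have hne : (μ hX).fundamentalClass ≠ 0 := fundamentalClass_ne_zero (μ hX)
  obtain ⟨φ, hφ⟩ : ∃ φ : Module.Dual ℂ (singularHomology ℂ ℂ (ComplexPoints X) (2 * d)),
      φ (μ hX).fundamentalClass ≠ 0 := by
    by_contra h
    push Not at h
    exact hne ((Module.forall_dual_apply_eq_zero_iff ℂ _).1 h)
  obtain ⟨G, hG⟩ := kroneckerPairing_surjective ℂ (ComplexPoints X) (2 * d) φ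
  exact ⟨G, by rw [hG]; exact hφ⟩

/-- **The cross product of non-zero top classes pairs non-trivially with `[(Y ⊗ Z)(ℂ)]`**, GRANTED
the Künneth spanning property in the top degree (it spans the top cohomology,
`exists_eq_smul_cross_of_top`, some element of which pairs non-trivially,
`exists_kroneckerPairing_fundamentalClass_ne_zero`). [cite: HatcherAT2002, §3.2 Thm. 3.15 and §3.3 Thm. 3.26] -/
theorem cupPairing_cross_top_ne_zero (μ : OrientationFamily)
    (hY : IsSmoothProjective m Y) (hZ : IsSmoothProjective n Z)
    (hKtop : ∀ z : complexBetti (Y ⊗ Z) (2 * (m + n)), z ∈ Submodule.span ℂ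
      {v | ∃ (i j : ℕ) (h : i + j = 2 * (m + n)) (b : complexBetti Y i) (w : complexBetti Z j),
        v = cupProduct h (complexBetti.map (fst Y Z) i b) (complexBetti.map (snd Y Z) j w)})
    {ω₀ : complexBetti Y (2 * m)} (hω₀ : ω₀ ≠ 0) {w₀ : complexBetti Z (2 * n)} (hw₀ : w₀ ≠ 0)
    (h2 : 2 * m + 2 * n = 2 * (m + n)) :
    cupPairing (μ (IsSmoothProjective.tensor_holds hY hZ)) h2 (complexBetti.map (fst Y Z) (2 * m) ω₀)
      (complexBetti.map (snd Y Z) (2 * n) w₀) ≠ 0 := by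
  intro h0
  obtain ⟨G, hG⟩ := exists_kroneckerPairing_fundamentalClass_ne_zero μ (IsSmoothProjective.tensor_holds hY hZ)
  obtain ⟨t, rfl⟩ := exists_eq_smul_cross_of_top μ hY hZ hKtop hω₀ hw₀ h2 G
  rw [cupPairing_apply] at h0
  rw [map_smul, LinearMap.smul_apply, h0, smul_zero] at hG
  exact hG rfl

/-! ### Fibre integration -/

/-- **Fibre integration along the first projection: `fst_*(snd^* w₀) = κ • 1_Y` with `κ ≠ 0`** for a
non-zero top class `w₀ ∈ H^{2 dim Z}(Z(ℂ))`, GRANTED the Künneth spanning property in the top degree of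
`(Y ⊗ Z)(ℂ)`. Indeed `fst_*(snd^* w₀) ∈ H⁰(Y(ℂ)) = ℂ · 1` (`exists_eq_smul_one`), and for a non-zero top
class `ω₀` of `Y`, `⟨fst_*(snd^* w₀) ∪ ω₀, [Y]⟩ = ⟨snd^* w₀ ∪ fst^* ω₀, [Y ⊗ Z]⟩ = ⟨fst^* ω₀ ∪ snd^* w₀, [Y ⊗ Z]⟩ ≠ 0`
(`cupPairing_gysinMap`, `cupPairing_cross_top_ne_zero`). This is the base change
`fst_* snd^* = π^* s_*` for the product square over the point (Fulton, *Young Tableaux*, App. B)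
in the only form the route needs. [cite: FultonYoungTableaux1997, Appendix B §B.1 (4)–(5)]
[cite: HatcherAT2002, §3.2 Thm. 3.15] -/
theorem exists_fibreIntegral_fst (μ : OrientationFamily)
    (hY : IsSmoothProjective m Y) (hZ : IsSmoothProjective n Z)
    (hKtop : ∀ z : complexBetti (Y ⊗ Z) (2 * (m + n)), z ∈ Submodule.span ℂ
      {v | ∃ (i j : ℕ) (h : i + j = 2 * (m + n)) (b : complexBetti Y i) (w : complexBetti Z j),
        v = cupProduct h (complexBetti.map (fst Y Z) i b) (complexBetti.map (snd Y Z) j w)})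
    {w₀ : complexBetti Z (2 * n)} (hw₀ : w₀ ≠ 0) (hdeg : 2 * n + 2 * m = 0 + 2 * (m + n)) :
    ∃ κ : ℂ, κ ≠ 0 ∧
      complexGysin μ (IsSmoothProjective.tensor_holds hY hZ) hY (fst Y Z) hdeg
          (complexBetti.map (snd Y Z) (2 * n) w₀) =
        κ • singularCohomology.one ℂ (ComplexPoints Y) := by
  have hP := IsSmoothProjective.tensor_holds hY hZ
  obtain ⟨κ, hκ⟩ := exists_eq_smul_one μ hY
    (complexGysin μ hP hY (fst Y Z) hdeg (complexBetti.map (snd Y Z) (2 * n) w₀))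
  refine ⟨κ, ?_, hκ⟩
  rintro rfl
  rw [zero_smul] at hκ
  obtain ⟨ω₀, hω₀⟩ := exists_kroneckerPairing_fundamentalClass_ne_zero μ hY
  have hω₀0 : ω₀ ≠ 0 := by
    rintro rfl
    exact hω₀ (by rw [map_zero, LinearMap.zero_apply])
  have h2 : 2 * m + 2 * n = 2 * (m + n) := by omega
  apply cupPairing_cross_top_ne_zero μ hY hZ hKtop hω₀0 hw₀ h2
  -- `⟨fst_*(snd^* w₀) ∪ ω₀, [Y]⟩ = ⟨snd^* w₀ ∪ fst^* ω₀, [P]⟩ = ⟨fst^* ω₀ ∪ snd^* w₀, [P]⟩`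
  have ha : 2 * n + 2 * m = 2 * (m + n) := by omega
  have key := cupPairing_gysinMap (μY := μ hP) (μ.hasPoincareDuality hY)
    (AlgPoints.mapContinuous (L := ℂ) (fst Y Z)) ha (Nat.zero_add (2 * m))
    (complexBetti.map (snd Y Z) (2 * n) w₀) ω₀
  rw [← complexGysin_eq_gysinMap hP hY (fst Y Z) hdeg ha (Nat.zero_add (2 * m)), hκ, map_zero,
    LinearMap.zero_apply] at key
  change (0 : ℂ) = cupPairing (μ hP) ha (complexBetti.map (snd Y Z) (2 * n) w₀)
    (complexBetti.map (fst Y Z) (2 * m) ω₀) at key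
  rw [cupPairing_apply, cupProduct_gradedComm_holds ℂ _ ha h2, map_smul, LinearMap.smul_apply,
    ← cupPairing_apply] at key
  have hsign : ((-1 : ℂ) ^ (2 * n * (2 * m))) = 1 := by
    rw [show 2 * n * (2 * m) = 2 * (n * (2 * m)) by ring, pow_mul, neg_one_sq, one_pow]
  rw [hsign, one_smul] at key
  exact key.symm

/-- **Fibre integration along the second projection: `snd_*(fst^* ω₀) = κ • 1_Z` with `κ ≠ 0`** for a
non-zero top class `ω₀ ∈ H^{2 dim Y}(Y(ℂ))`, GRANTED the Künneth spanning property in the top degree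
(as `exists_fibreIntegral_fst`, with `⟨snd_*(fst^* ω₀) ∪ w₀, [Z]⟩ = ⟨fst^* ω₀ ∪ snd^* w₀, [Y ⊗ Z]⟩`).
[cite: FultonYoungTableaux1997, Appendix B §B.1 (4)–(5)] [cite: HatcherAT2002, §3.2 Thm. 3.15] -/
theorem exists_fibreIntegral_snd (μ : OrientationFamily)
    (hY : IsSmoothProjective m Y) (hZ : IsSmoothProjective n Z)
    (hKtop : ∀ z : complexBetti (Y ⊗ Z) (2 * (m + n)), z ∈ Submodule.span ℂ
      {v | ∃ (i j : ℕ) (h : i + j = 2 * (m + n)) (b : complexBetti Y i) (w : complexBetti Z j),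
        v = cupProduct h (complexBetti.map (fst Y Z) i b) (complexBetti.map (snd Y Z) j w)})
    {ω₀ : complexBetti Y (2 * m)} (hω₀ : ω₀ ≠ 0) (hdeg : 2 * m + 2 * n = 0 + 2 * (m + n)) :
    ∃ κ : ℂ, κ ≠ 0 ∧
      complexGysin μ (IsSmoothProjective.tensor_holds hY hZ) hZ (snd Y Z) hdeg
          (complexBetti.map (fst Y Z) (2 * m) ω₀) =
        κ • singularCohomology.one ℂ (ComplexPoints Z) := by
  have hP := IsSmoothProjective.tensor_holds hY hZ
  obtain ⟨κ, hκ⟩ := exists_eq_smul_one μ hZ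
    (complexGysin μ hP hZ (snd Y Z) hdeg (complexBetti.map (fst Y Z) (2 * m) ω₀))
  refine ⟨κ, ?_, hκ⟩
  rintro rfl
  rw [zero_smul] at hκ
  obtain ⟨w₀, hw₀⟩ := exists_kroneckerPairing_fundamentalClass_ne_zero μ hZ
  have hw₀0 : w₀ ≠ 0 := by
    rintro rfl
    exact hw₀ (by rw [map_zero, LinearMap.zero_apply])
  have h2 : 2 * m + 2 * n = 2 * (m + n) := by omega
  apply cupPairing_cross_top_ne_zero μ hY hZ hKtop hω₀ hw₀0 h2
  have key := cupPairing_gysinMap (μY := μ hP) (μ.hasPoincareDuality hZ)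
    (AlgPoints.mapContinuous (L := ℂ) (snd Y Z)) h2 (Nat.zero_add (2 * n))
    (complexBetti.map (fst Y Z) (2 * m) ω₀) w₀
  rw [← complexGysin_eq_gysinMap hP hZ (snd Y Z) hdeg h2 (Nat.zero_add (2 * n)), hκ, map_zero,
    LinearMap.zero_apply] at key
  exact key.symm

end Summit.HodgeConjecture.HodgeConjecture.Theorems.NikulinTwinTransport

end
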